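import Literature.IUT.HodgeTheaters.InitialThetaDataTorsionMonodromy
import Literature.NumberTheory.EllipticCurves.GaloisAction
import Literature.NumberTheory.EllipticCurves.DivisionPolynomialTorsion
import Literature.AnabelianGeometry.EtaleTheta.SettingModelSemidirectTopology
import Mathlib.Algebra.GroupWithZero.Units.Fintype
import Mathlib.GroupTheory.NoncommCoprod
import HarnessLib

/-!
# [IUTchI] Def 3.1 (b)(c)(d) / [EtTh] Def 2.1: the SEMIDIRECT model `Π_{C_F} := E_F[l](F̄) ⋊ (G_F × {±1})` of the
# `π₁`-interface — the packaging that CARRIES the `l`-torsion monodromy (NV-L5 witness, part 1: the group)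

S. Mochizuki, *Inter-universal Teichmüller theory I*, kurims manuscript (May 2020), §3 Definition 3.1 (b) p. 61
«`X_F` … a once-punctured elliptic curve», «`C_F` … by the unique `F`-involution `−1`», (c) p. 62 l. 4–12 «the
image of the outer homomorphism `G_F → GL₂(𝔽_l)` determined by the `l`-torsion points of `E_F` contains the
subgroup `SL₂(𝔽_l)`; `K ⊆ F̄` … the finite Galois extension of `F` determined by the kernel of this homomorphism»,
(d) p. 62 «`C̲_K` is a hyperbolic orbicurve of type `(1, l-tors)±` … determines … `X̲_K` of type `(1, l-tors)`
[cf. [EtTh], Definition 2.1]»; [EtTh] Def 2.1 p. 36 «`Δ̄^ell_X = Δ_X^{ab} ⊗ ℤ/lℤ` … a free `(ℤ/lℤ)`-module of rank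
`2`», «a quotient onto a free `(ℤ/lℤ)`-module `Q` of rank `1` … the corresponding covering `X̲^log → X^log`»
([IUTchI] Def 3.1 (b)(c)(d) p.61–62) [claim: Mochizuki2012, status: disputed] (D-0012 claim key; series status
DISPUTED — this file CONSTRUCTS A MODEL of the cell's `π₁`-INTERFACE structures; nothing of the series is asserted
and no side is taken on [IUTchIII] Cor. 3.12).

## WHY (NV-L5 register «TorsionMonodromy-NV», abc-iut-L5-lead GO 2026-08-26T10:03Z; successor of abc-iut-L5-t8 gen 5)

The interface datum `InitialThetaData.TorsionMonodromy D` (the monodromy `Π_{X_F} ↠ E_F[l](F̄) ⋊ G_F` by its cocycle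
`τ` and the line cutting out `Π_{X̲_K}`) is a NAMED DATUM; the binder `Nonempty D.TorsionMonodromy` of
`toFlStarGlobal_surjective_of_torsionMonodromy` (Def 6.1 (v)) must be SATISFIABLE at genuine initial Θ-data (KIT RULE).
No PRODUCT model `Π_{C_F} = G_F × (finite)` can carry it (the cocycle law with `τ(Δ_X) = E_F[l](F̄)` forces `G_F` to act
on the `E_F[l]`-part THROUGH ITS GENUINE ACTION ON THE `l`-TORSION); this file builds the semidirect packaging, with
the involution of `C_F` acting by `−1` (print's «type `(1, l-tors)±`»).

## WHAT (this file = the normal factor and the continuous action; parts 2–3 = `…ModelKLevel/Geometry.lean`)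

For fields `F ⊆ F̄` (one universe), an elliptic curve `E = E_F` over `F` and `l`: `Tors E Fbar l` — the REAL `l`-torsion
`E_F[l](F̄) = AddSubgroup.torsionBy E_F(F̄) l` (multiplicative notation, discrete, finite by the tree's
`WeierstrassCurve.finite_torsionBy_baseChange`, Silverman AEC III.6.4); `torsRep : G_F →* Aut E_F[l](F̄)` — the GENUINE
mod-`l` representation (`galoisAct`), with OPEN kernel (`isOpen_ker_torsRep`); `sgnRep : ℤˣ →* Aut`, `±1 ↦ (P ↦ ±P)`;
`act := torsRep · sgnRep` on `G_F × ℤˣ`, jointly continuous; `PiC F E Fbar l := E_F[l](F̄) ⋊[act] (G_F × ℤˣ)` — a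
PROFINITE group by the tree's generic `SettingModel.Semidirect.*` API (abc-iut-L2); `ext` — the augmentation
`⟨t, (σ, u)⟩ ↦ σ` as a `FundamentalExtension` (abc-iut-L4-t1); `PiX := Ker(sgn : Π_{C_F} → ℤˣ) = E_F[l] ⋊ (G_F × 1)`
(open, normal, index `2`, `↠ G_F`), so `Δ_X = E_F[l](F̄)` and **`Π_{C_F}` acts on `Δ_X = Δ_X^{ab} ⊗ 𝔽_l` by
`sgn(g) · ρ(σ_g)`** — as Def 6.1 (v) «[i.e., from the Galois action on `Δ_X^{ab} ⊗ 𝔽_l`]» and «`(1, l-tors)±`» demand.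

HONEST LABEL.  A MODEL of interface structures (consistency / non-vacuity evidence), not the étale fundamental group
of a curve: only the `Π_{C_F}`-module `Δ_X^{ab} ⊗ 𝔽_l ≅ E_F[l](F̄)` (Galois action and sign) is the curve's; `Δ_X`
itself is the finite group `E_F[l](F̄)`, not free profinite of rank `2`.  Instances are declared only on this file's
model types.  Instantiated ≠ endorsed; typed ≠ proved; no side taken on [IUTchIII] Cor. 3.12.
-/

noncomputable section

namespace Literature.IUT.HodgeTheaters

namespace TorsionMonodromyModel

open Literature.AnabelianGeometry.AbsoluteAnabelian Topology
open Literature.AnabelianGeometry.EtaleTheta.SettingModel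
open scoped WeierstrassCurve.Affine Classical

universe u

variable {F : Type u} [Field F] (E : WeierstrassCurve F) (Fbar : Type u) [Field Fbar] [Algebra F Fbar] (l : ℕ)

/-! ## The normal factor `E_F[l](F̄)` (multiplicative notation, discrete topology) -/

/-- `E_F[l](F̄) ⊆ E_F(F̄)`: the `l`-torsion subgroup of the `F̄`-points (Mathlib's `AddSubgroup.torsionBy`).
[cite: Mochizuki2012, IUTchI Def 3.1 (c) p.62] -/
abbrev torsion : AddSubgroup (GeomPoints Fbar E) := AddSubgroup.torsionBy (GeomPoints Fbar E) (l : ℤ)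

/-- The model's normal factor `Δ_X := E_F[l](F̄)` — [EtTh] Def 2.1 «`Δ̄^ell_X = Δ_X^{ab} ⊗ ℤ/lℤ`» — written
MULTIPLICATIVELY (Mathlib's `SemidirectProduct` wants a multiplicative group); a model type of this file.
[cite: Mochizuki2012, IUTchI Def 3.1 (c) p.62] -/
abbrev Tors : Type u := Multiplicative ↥(torsion E Fbar l)

namespace Tors

/-- The discrete topology on the finite normal factor. [folklore] -/
instance instTopologicalSpace : TopologicalSpace (Tors E Fbar l) := ⊥

/-- The topology is discrete by definition. [folklore] -/
instance instDiscreteTopology : DiscreteTopology (Tors E Fbar l) := ⟨rfl⟩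

/-- A discrete group is a topological group. [folklore] -/
instance instIsTopologicalGroup : IsTopologicalGroup (Tors E Fbar l) where
  continuous_mul := continuous_of_discreteTopology
  continuous_inv := continuous_of_discreteTopology

/-- `E_F[l](F̄)` is finite (`l ≠ 0`; Silverman AEC III.6.4). [cite: Mochizuki2012, IUTchI Def 3.1 (c) p.62] -/
instance instFinite [E.IsElliptic] [NeZero l] : Finite (Tors E Fbar l) :=
  haveI : Finite ↥(torsion E Fbar l) :=
    WeierstrassCurve.finite_torsionBy_baseChange E Fbar (n := (l : ℤ)) (by exact_mod_cast NeZero.ne l)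
  Finite.of_equiv _ Multiplicative.ofAdd

variable {E Fbar l}

/-- The underlying `F̄`-point of an element of the normal factor. [cite: Mochizuki2012, IUTchI Def 3.1 (c) p.62] -/
def pt (t : Tors E Fbar l) : GeomPoints Fbar E := ((Multiplicative.toAdd t : ↥(torsion E Fbar l)) : GeomPoints Fbar E)

/-- An `l`-torsion point as an element of the normal factor. [cite: Mochizuki2012, IUTchI Def 3.1 (c) p.62] -/
def ofPt (P : GeomPoints Fbar E) (hP : (l : ℤ) • P = 0) : Tors E Fbar l :=
  Multiplicative.ofAdd (⟨P, (Submodule.mem_torsionBy_iff (l : ℤ) P).mpr hP⟩ : ↥(torsion E Fbar l))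

/-- [cite: Mochizuki2012, IUTchI Def 3.1 (c) p.62] -/
@[simp] theorem pt_ofPt (P : GeomPoints Fbar E) (hP : (l : ℤ) • P = 0) : pt (ofPt P hP : Tors E Fbar l) = P := rfl

/-- [cite: Mochizuki2012, IUTchI Def 3.1 (c) p.62] -/
@[simp] theorem pt_mul (s t : Tors E Fbar l) : pt (s * t) = pt s + pt t := rfl

/-- [cite: Mochizuki2012, IUTchI Def 3.1 (c) p.62] -/
@[simp] theorem pt_one : pt (1 : Tors E Fbar l) = 0 := rfl

/-- [cite: Mochizuki2012, IUTchI Def 3.1 (c) p.62] -/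
@[simp] theorem pt_inv (t : Tors E Fbar l) : pt t⁻¹ = -pt t := rfl

/-- [cite: Mochizuki2012, IUTchI Def 3.1 (c) p.62] -/
@[simp] theorem pt_zpow (t : Tors E Fbar l) (a : ℤ) : pt (t ^ a) = a • pt t := by
  unfold pt
  rw [toAdd_zpow, AddSubgroup.coe_zsmul]

/-- `pt` is injective. [cite: Mochizuki2012, IUTchI Def 3.1 (c) p.62] -/
theorem pt_injective : Function.Injective (pt : Tors E Fbar l → GeomPoints Fbar E) :=
  fun _ _ h => Multiplicative.toAdd.injective (Subtype.ext h)

/-- [cite: Mochizuki2012, IUTchI Def 3.1 (c) p.62] -/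
theorem pt_eq_zero_iff (t : Tors E Fbar l) : pt t = 0 ↔ t = 1 := by
  rw [← pt_one (E := E) (Fbar := Fbar) (l := l)]
  exact pt_injective.eq_iff

/-- Every element of the normal factor is an `l`-torsion point. [cite: Mochizuki2012, IUTchI Def 3.1 (c) p.62] -/
theorem torsion_pt (t : Tors E Fbar l) : (l : ℤ) • pt t = 0 :=
  (Submodule.mem_torsionBy_iff (l : ℤ) _).mp (Multiplicative.toAdd t).2

/-- `t ^ l = 1` in the normal factor. [cite: Mochizuki2012, IUTchI Def 3.1 (c) p.62] -/
theorem pow_l (t : Tors E Fbar l) : t ^ l = 1 := by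
  rw [← pt_eq_zero_iff, ← zpow_natCast, pt_zpow]
  exact torsion_pt t

/-- A nontrivial element has order `l` (`l` prime). [cite: Mochizuki2012, IUTchI Def 3.1 (c) p.62] -/
theorem orderOf_eq (hl : l.Prime) {t : Tors E Fbar l} (ht : t ≠ 1) : orderOf t = l :=
  haveI : Fact l.Prime := ⟨hl⟩
  orderOf_eq_prime (pow_l t) ht

/-- `#(ℤ·g) = l` for `g ≠ 1` (`l` prime). [cite: Mochizuki2012, IUTchI Def 3.1 (c) p.62] -/
theorem card_zpowers (hl : l.Prime) {g : Tors E Fbar l} (hg : g ≠ 1) : Nat.card ↥(Subgroup.zpowers g) = l := by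
  rw [Nat.card_zpowers, orderOf_eq hl hg]

end Tors

/-! ## The Galois side `G_F × {±1}` and its action on `E_F[l](F̄)` -/

variable (F) in
/-- The quotient side `G_F × Gal(X_F/C_F) = (F̄ ≃ₐ[F] F̄) × {±1}` (Krull × discrete). [cite: Mochizuki2012, IUTchI Def 3.1 (b) p.61] -/
abbrev GalPM : Type u := (Fbar ≃ₐ[F] Fbar) × ℤˣ

/-- **The mod-`l` Galois representation** `G_F → Aut(E_F[l](F̄))` of Def 3.1 (c) «the outer homomorphism
`G_F → GL₂(𝔽_l)` determined by the `l`-torsion points of `E_F`», on the model's (multiplicative) normal factor: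
`σ ↦ (t ↦ σ·t)` (Mathlib's `Point.map`, = `galoisAct`). [cite: Mochizuki2012, IUTchI Def 3.1 (c) p.62] -/
def torsRep : (Fbar ≃ₐ[F] Fbar) →* MulAut (Tors E Fbar l) :=
  (MulAutMultiplicative ↥(torsion E Fbar l)).symm.toMonoidHom.comp
    (DistribMulAction.toAddAut (Fbar ≃ₐ[F] Fbar) ↥(torsion E Fbar l))

/-- `torsRep σ` IS the Galois action `galoisAct E σ` on points. [cite: Mochizuki2012, IUTchI Def 3.1 (c) p.62] -/
@[simp] theorem pt_torsRep (σ : Fbar ≃ₐ[F] Fbar) (t : Tors E Fbar l) :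
    Tors.pt (torsRep E Fbar l σ t) = galoisAct E σ (Tors.pt t) := rfl

/-- **The sign representation** `{±1} → Aut(E_F[l](F̄))`, `u ↦ (P ↦ u·P)`: the involution `−1` of `E_F` (Def 3.1 (b)
«`C_F` … the quotient of `X_F` by the unique `F`-involution `−1`») on the `l`-torsion.
[cite: Mochizuki2012, IUTchI Def 3.1 (b) p.61] -/
def sgnRep : ℤˣ →* MulAut (Tors E Fbar l) :=
  (MulAutMultiplicative ↥(torsion E Fbar l)).symm.toMonoidHom.comp (DistribMulAction.toAddAut ℤˣ ↥(torsion E Fbar l))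

/-- `sgnRep u` is multiplication by `u = ±1` on points. [cite: Mochizuki2012, IUTchI Def 3.1 (b) p.61] -/
@[simp] theorem pt_sgnRep (u : ℤˣ) (t : Tors E Fbar l) : Tors.pt (sgnRep E Fbar l u t) = (u : ℤ) • Tors.pt t := by
  change (((u • Multiplicative.toAdd t : ↥(torsion E Fbar l)) : GeomPoints Fbar E)) = (u : ℤ) • Tors.pt t
  rw [Units.smul_def, AddSubgroup.coe_zsmul]
  rfl

/-- The Galois action commutes with the sign. [cite: Mochizuki2012, IUTchI Def 3.1 (b)(c) p.61–62] -/
theorem commute_torsRep_sgnRep (σ : Fbar ≃ₐ[F] Fbar) (u : ℤˣ) :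
    Commute (torsRep E Fbar l σ) (sgnRep E Fbar l u) := by
  refine MulEquiv.ext fun t => Tors.pt_injective ?_
  rw [MulAut.mul_apply, MulAut.mul_apply, pt_torsRep, pt_sgnRep, pt_sgnRep, pt_torsRep, map_zsmul]

variable (F) in
/-- The action of `G_F × {±1}` on the normal factor: `(σ, u) ↦ ρ(σ) ∘ (u·)`. [cite: Mochizuki2012, IUTchI Def 3.1 (c) p.62] -/
def act : GalPM F Fbar →* MulAut (Tors E Fbar l) :=
  MonoidHom.noncommCoprod (torsRep E Fbar l) (sgnRep E Fbar l) (commute_torsRep_sgnRep E Fbar l)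

/-- `act (σ, u) t = σ·(u·t)`, on points: `u • galoisAct σ (pt t)`. [cite: Mochizuki2012, IUTchI Def 3.1 (c) p.62] -/
@[simp] theorem pt_act (q : GalPM F Fbar) (t : Tors E Fbar l) :
    Tors.pt (act F E Fbar l q t) = (q.2 : ℤ) • galoisAct E q.1 (Tors.pt t) := by
  rw [act, MonoidHom.noncommCoprod_apply, MulAut.mul_apply, pt_torsRep, pt_sgnRep, map_zsmul]

/-- `σ` is in the kernel of the mod-`l` representation iff it fixes every `l`-torsion point
(`FixesTorsion`, Def 3.1 (c) «the kernel of this homomorphism»). [cite: Mochizuki2012, IUTchI Def 3.1 (c) p.62] -/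
theorem mem_ker_torsRep_iff (σ : Fbar ≃ₐ[F] Fbar) : σ ∈ (torsRep E Fbar l).ker ↔ FixesTorsion E l σ := by
  rw [MonoidHom.mem_ker]
  constructor
  · intro h P hP
    have := congrArg Tors.pt (MulEquiv.congr_fun h (Tors.ofPt P hP : Tors E Fbar l))
    rwa [pt_torsRep, MulAut.one_apply, Tors.pt_ofPt] at this
  · intro h
    refine MulEquiv.ext fun t => Tors.pt_injective ?_
    rw [pt_torsRep]
    exact h _ (Tors.torsion_pt t)

/-- `torsRep σ = 1` on the normal factor when `σ` fixes the `l`-torsion. [cite: Mochizuki2012, IUTchI Def 3.1 (c) p.62] -/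
theorem torsRep_apply_of_fixesTorsion {σ : Fbar ≃ₐ[F] Fbar} (h : FixesTorsion E l σ) (t : Tors E Fbar l) :
    torsRep E Fbar l σ t = t := by
  rw [(mem_ker_torsRep_iff E Fbar l σ).mpr h, MulAut.one_apply]

/-- The stabiliser in `G_F` of a point of `E_F(F̄)` is OPEN for the Krull topology (`F̄/F` algebraic): a union of cosets
of the fixing subgroup of the finite extension generated by the coordinates (Silverman AEC VIII.§1; cf. the tree's
`WeierstrassCurve.isOpen_stabilizer_point_holds` for `F̄ = AlgebraicClosure F`). [cite: Mochizuki2012, IUTchI Def 3.1 (c) p.62] -/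
theorem isOpen_setOf_galoisAct_eq [Algebra.IsAlgebraic F Fbar] (P : GeomPoints Fbar E) :
    IsOpen {σ : Fbar ≃ₐ[F] Fbar | galoisAct E σ P = P} := by
  rcases P with (_ | ⟨x, y, h⟩)
  · convert isOpen_univ
    ext σ
    simp only [Set.mem_setOf_eq, Set.mem_univ, iff_true]
    exact map_zero _
  · let M : IntermediateField F Fbar := IntermediateField.adjoin F {x, y}
    haveI : FiniteDimensional F M :=
      IntermediateField.finiteDimensional_adjoin fun z _ => (Algebra.IsAlgebraic.isAlgebraic z).isIntegral
    have hsub : (M.fixingSubgroup : Set (Fbar ≃ₐ[F] Fbar)) ⊆ {σ | galoisAct E σ (.some x y h) = .some x y h} := by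
      intro σ hσ
      rw [SetLike.mem_coe, IntermediateField.mem_fixingSubgroup_iff] at hσ
      have hx : σ x = x := hσ x (IntermediateField.subset_adjoin F _ (by simp))
      have hy : σ y = y := hσ y (IntermediateField.subset_adjoin F _ (by simp))
      show WeierstrassCurve.Affine.Point.map (σ : Fbar →ₐ[F] Fbar) (.some x y h) = .some x y h
      rw [WeierstrassCurve.Affine.Point.map_some]
      congr 1
    rw [isOpen_iff_mem_nhds]
    intro σ hσ
    have hopen : IsOpen ((fun τ => σ⁻¹ * τ) ⁻¹' (M.fixingSubgroup : Set (Fbar ≃ₐ[F] Fbar))) :=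
      M.fixingSubgroup_isOpen.preimage (continuous_const.mul continuous_id)
    refine Filter.mem_of_superset (hopen.mem_nhds ?_) ?_
    · show σ⁻¹ * σ ∈ (M.fixingSubgroup : Set (Fbar ≃ₐ[F] Fbar))
      rw [inv_mul_cancel]
      exact M.fixingSubgroup.one_mem
    · intro τ hτ
      have h1 : galoisAct E (σ⁻¹ * τ) (.some x y h) = .some x y h := hsub hτ
      have h2 : galoisAct E σ (galoisAct E (σ⁻¹ * τ) (.some x y h)) = galoisAct E τ (.some x y h) := by
        change (σ * (σ⁻¹ * τ)) • (WeierstrassCurve.Affine.Point.some x y h : GeomPoints Fbar E) = τ • _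
        rw [mul_inv_cancel_left]
      rw [h1] at h2
      show galoisAct E τ (.some x y h) = .some x y h
      rw [← h2]
      exact hσ

/-- **The mod-`l` representation is continuous**: its kernel `Gal(F̄/F(E_F[l]))` is OPEN (finite intersection of
open stabilisers; Silverman AEC III.§7). [cite: Mochizuki2012, IUTchI Def 3.1 (c) p.62] -/
theorem isOpen_ker_torsRep [Algebra.IsAlgebraic F Fbar] [E.IsElliptic] [NeZero l] :
    IsOpen ((torsRep E Fbar l).ker : Set (Fbar ≃ₐ[F] Fbar)) := by
  have h : ((torsRep E Fbar l).ker : Set (Fbar ≃ₐ[F] Fbar)) =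
      ⋂ t : Tors E Fbar l, {σ | galoisAct E σ (Tors.pt t) = Tors.pt t} := by
    ext σ
    rw [SetLike.mem_coe, mem_ker_torsRep_iff, Set.mem_iInter]
    constructor
    · intro hσ t
      exact hσ _ (Tors.torsion_pt t)
    · intro hσ P hP
      have := hσ (Tors.ofPt P hP)
      rwa [Set.mem_setOf_eq, Tors.pt_ofPt] at this
  rw [h]
  exact isOpen_iInter_of_finite fun t => isOpen_setOf_galoisAct_eq E Fbar (Tors.pt t)

/-- A homomorphism into the automorphisms of a DISCRETE group with OPEN kernel gives a jointly continuous action.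
[folklore] -/
private theorem continuous_action_of_isOpen_ker {G N : Type*} [Group G] [TopologicalSpace G] [IsTopologicalGroup G]
    [Group N] [TopologicalSpace N] [DiscreteTopology N] (ρ : G →* MulAut N) (hρ : IsOpen (ρ.ker : Set G)) :
    Continuous fun q : G × N => ρ q.1 q.2 := by
  refine continuous_def.2 fun S _ => ?_
  rw [isOpen_iff_mem_nhds]
  rintro ⟨g, n⟩ hq
  have hV : IsOpen ((fun q : G × N => (g⁻¹ * q.1, q.2)) ⁻¹' ((ρ.ker : Set G) ×ˢ {n})) :=
    (hρ.prod (isOpen_discrete _)).preimage ((continuous_const.mul continuous_fst).prodMk continuous_snd)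
  refine Filter.mem_of_superset (hV.mem_nhds ?_) ?_
  · show (g⁻¹ * g, n) ∈ (ρ.ker : Set G) ×ˢ ({n} : Set N)
    rw [inv_mul_cancel]
    exact ⟨ρ.ker.one_mem, rfl⟩
  · rintro ⟨g', n'⟩ ⟨hg', hn'⟩
    have hn'' : n' = n := hn'
    subst hn''
    have hk : ρ (g⁻¹ * g') = 1 := hg'
    show ρ g' n' ∈ S
    have : ρ g' n' = ρ g n' := by
      conv_lhs => rw [← mul_inv_cancel_left g g', map_mul, hk, mul_one]
    rw [this]
    exact hq

/-- The action of `G_F × {±1}` on `E_F[l](F̄)` is jointly continuous (`Ker ⊇ Ker ρ × 1`, open). [cite: Mochizuki2012, IUTchI Def 3.1 (c) p.62] -/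
theorem continuous_act [Algebra.IsAlgebraic F Fbar] [E.IsElliptic] [NeZero l] :
    Continuous fun q : GalPM F Fbar × Tors E Fbar l => act F E Fbar l q.1 q.2 := by
  refine continuous_action_of_isOpen_ker (act F E Fbar l) ?_
  refine Subgroup.isOpen_mono (H₁ := (torsRep E Fbar l).ker.prod ⊥) ?_ ?_
  · rintro ⟨σ, u⟩ h
    rw [Subgroup.mem_prod, Subgroup.mem_bot] at h
    obtain ⟨hσ, hu⟩ := h
    dsimp only at hσ hu
    subst hu
    rw [MonoidHom.mem_ker] at hσ ⊢
    rw [act, MonoidHom.noncommCoprod_apply, map_one, mul_one]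
    exact hσ
  · rw [Subgroup.coe_prod, Subgroup.coe_bot]
    exact (isOpen_ker_torsRep E Fbar l).prod (isOpen_discrete _)

end TorsionMonodromyModel

end Literature.IUT.HodgeTheaters

end
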